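import Literature.NumberTheory.EllipticCurves.TateCurve.NumberFieldUniformization
import HarnessLib

/-!
# Tate's `v`-adic uniformisation at a place of SPLIT multiplicative reduction WITH the `j`-clause
# `j(E_q) = j(E)` and the valuation of the Tate parameter (Silverman, *Advanced Topics*, Thm. V.5.3, Lemma V.5.1)

Topic `Literature/NumberTheory/EllipticCurves/TateCurve`, namespace
`Literature.NumberTheory.EllipticCurves.TateCurve`. Proof-only file (theorems only; no definition, no named fact), a
re-assembly of the tree's DISCHARGED named fact `Silverman1994_thmV53_tateUniformisation`
(`NumberFieldUniformization.lean`, `Silverman1994_thmV53_tateUniformisation_holds`) that ALSO exports the two clauses the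
packaged statement drops — exactly as `NumberFieldUniformizationTwistedTateJ.lean` does for the twisted form:

* `exists_tateUniformisation_tateJ`: for an elliptic curve `W` over a number field `K` (universe `0`) with SPLIT
  multiplicative reduction at `v`, there are `q ∈ K_v` with `q ≠ 0`, `v(q) < 1`, `v(q) = v(j(W ⊗ K_v))⁻¹` AND
  **`tateJ q = j(W ⊗ K_v)`** (V.5.3 (a): "`q` … such that `j(E_q) = j(E)`"), and a surjective homomorphism
  `Φ : K̄_v^* → E(K̄_v)` with kernel `q^ℤ`, honestly `Γ_{K_v}`-equivariant `σ • Φ(u) = Φ(σ u)`, whose `Γ_{K_v}`-fixed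
  points come from `K_vˣ`.

Why the extra clause (cell `bsd-2adic`, seat bsd-2adic-tower-1 GEN 10): the unit part of the Tate parameter modulo `8`
at a split multiplicative `2`, `q/2^{v(q)} ≡ (Δ_min/2^{v(Δ)})·c₄ (mod 8)` (`…MultTowerNS2TateUnitAtTwo.lean`), is read off
`tateJ q = j(E) = c₄³/Δ`; the `∃ q` of the packaged fact cannot be linked to `j(E)` without it. The proof is the
predecessor's verbatim (`exists_tateParameter_of_hasSplitMultiplicativeReductionAt` + `uniformization_holds` transported
along `localPointsEquivTate`), keeping `hqj` and `‖q‖ = ‖j‖⁻¹`. No instance attribute is used (the norm clauses of the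
predecessors are converted to `Valued.v` by `Valued.toNormedField.norm_lt_one_iff` / `valuation_eq_inv_of_norm_eq_inv`).

## References
* [SilvermanATAEC1994] J. H. Silverman, *Advanced Topics in the Arithmetic of Elliptic Curves*, GTM 151, Springer
  1994, Lemma V.5.1, Thm. V.5.3 (a),(b) (PDF pp. 406–409), Thm. V.3.1 (b),(c),(d) (PDF p. 395).
-/

noncomputable section

open scoped Classical
open NumberField IsDedekindDomain WeierstrassCurve Field

namespace Literature.NumberTheory.EllipticCurves.TateCurve

open SteinWuthrich2013 Literature.NumberTheory.EllipticCurves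

variable {K : Type} [Field K] [NumberField K] (W : WeierstrassCurve K) [W.IsElliptic]
  (v : HeightOneSpectrum (𝓞 K))

/-- **Silverman *ATAEC* Thm. V.5.3 with V.3.1 (c),(d) and Lemma V.5.1: Tate's `v`-adic uniformisation at a place of
SPLIT multiplicative reduction, WITH `j(E_q) = j(E)` and `v(q) = v(j)⁻¹`.** For an elliptic curve `W` over a number
field `K` with split multiplicative reduction at the finite place `v`, there are `q ∈ K_v` with `q ≠ 0`, `v(q) < 1`,
`v(q) = v(j(W ⊗ K_v))⁻¹`, `tateJ q = j(W ⊗ K_v)`, and a surjective homomorphism `Φ : K̄_v^* → E(K̄_v)` with kernel `q^ℤ`,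
`Γ_{K_v}`-equivariant (`σ • Φ(u) = Φ(σ u)`), whose `Γ_{K_v}`-fixed points come from `K_vˣ`. Proof = the tree's
`Silverman1994_thmV53_tateUniformisation_holds`, keeping the clauses `tateJ q = j` and `‖q‖ = ‖j‖⁻¹` of
`exists_tateParameter_of_hasSplitMultiplicativeReductionAt`.
[cite: SilvermanATAEC1994, Lemma V.5.1, Thm. V.5.3 (a),(b) (PDF pp. 406–409) and Thm. V.3.1 (c)(d) (PDF p. 395)] -/
theorem exists_tateUniformisation_tateJ (hsplit : W.HasSplitMultiplicativeReductionAt v) :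
    ∃ (q : v.adicCompletion K)
      (Φ : Additive (AlgebraicClosure (v.adicCompletion K))ˣ →+ localPoints W (v.adicCompletion K)),
      q ≠ 0 ∧ Valued.v q < 1 ∧
      Valued.v q = (Valued.v ((W.baseChange (v.adicCompletion K)).j))⁻¹ ∧
      tateJ q = (W.baseChange (v.adicCompletion K)).j ∧
      Function.Surjective Φ ∧
      (∀ u : (AlgebraicClosure (v.adicCompletion K))ˣ, Φ (Additive.ofMul u) = 0 ↔
        ∃ n : ℤ, (u : AlgebraicClosure (v.adicCompletion K)) =
          algebraMap (v.adicCompletion K) (AlgebraicClosure (v.adicCompletion K)) q ^ n) ∧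
      (∀ (σ : absoluteGaloisGroup (v.adicCompletion K))
          (u : (AlgebraicClosure (v.adicCompletion K))ˣ),
        σ • Φ (Additive.ofMul u) =
          Φ (Additive.ofMul (Units.map
            (Field.absoluteGaloisGroup.toAlgEquiv (v.adicCompletion K) σ :
              AlgebraicClosure (v.adicCompletion K) →* AlgebraicClosure (v.adicCompletion K))
            u))) ∧
      (∀ P : localPoints W (v.adicCompletion K),
        (∀ σ : absoluteGaloisGroup (v.adicCompletion K), σ • P = P) →
        ∃ u : (v.adicCompletion K)ˣ,
          Φ (Additive.ofMul (Units.map (algebraMap (v.adicCompletion K)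
            (AlgebraicClosure (v.adicCompletion K)) : v.adicCompletion K →*
              AlgebraicClosure (v.adicCompletion K)) u)) = P) := by
  letI := GaloisRepresentations.Ultrametric.AdicCompletion.nontriviallyNormedField K v
  haveI := charZero_adicCompletion' K v
  -- V.5.3: the Tate parameter (with `tateJ q = j`, `‖q‖ = ‖j‖⁻¹`) and the `K_v`-isomorphism `C • (W ⊗ K_v) = E_q`
  obtain ⟨q, hq0, hq, hqj, hqn, C, hC⟩ :=
    exists_tateParameter_of_hasSplitMultiplicativeReductionAt K v W hsplit
  have hj : (W.baseChange (v.adicCompletion K)).j = algebraMap K (v.adicCompletion K) W.j := W.map_j _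
  -- V.3.1 (c)(d): Tate's `φ` over `K̄_v`
  obtain ⟨φ, hsurj, hker, hequiv, hrat⟩ := uniformization_holds q hq0 hq
  let e := localPointsEquivTate W v C hC
  refine ⟨q, e.symm.toAddMonoidHom.comp φ, hq0, ?_, ?_, ?_, ?_, ?_, ?_, ?_⟩
  · exact (Valued.toNormedField.norm_lt_one_iff).mp hq
  · rw [hj]
    exact valuation_eq_inv_of_norm_eq_inv K v hqn
  · rw [hj]
    exact hqj
  · exact e.symm.surjective.comp hsurj
  · intro u
    rw [← hker u]
    change e.symm (φ (Additive.ofMul u)) = 0 ↔ _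
    rw [AddEquiv.map_eq_zero_iff]
  · intro σ u
    change σ • e.symm (φ (Additive.ofMul u)) = e.symm (φ _)
    rw [← hequiv σ u]
    apply e.injective
    rw [AddEquiv.apply_symm_apply, localPointsEquivTate_smul, AddEquiv.apply_symm_apply]
  · intro P hP
    have hP' : ∀ σ : absoluteGaloisGroup (v.adicCompletion K),
        absoluteGaloisGroup.toAlgEquiv (v.adicCompletion K) σ ∈
          (⊥ : IntermediateField (v.adicCompletion K)
            (AlgebraicClosure (v.adicCompletion K))).fixingSubgroup → σ • e P = e P := by
      intro σ _
      rw [← localPointsEquivTate_smul, hP σ]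
    obtain ⟨u, hu, hφ⟩ := hrat ⊥ (e P) hP'
    rw [IntermediateField.mem_bot] at hu
    obtain ⟨x, hx⟩ := hu
    have hx0 : x ≠ 0 := by
      intro h
      apply u.ne_zero
      rw [← hx, h, map_zero]
    refine ⟨Units.mk0 x hx0, ?_⟩
    have hux : Units.map (algebraMap (v.adicCompletion K) (AlgebraicClosure (v.adicCompletion K)) :
        v.adicCompletion K →* AlgebraicClosure (v.adicCompletion K)) (Units.mk0 x hx0) = u :=
      Units.ext (by simp [hx])
    change e.symm (φ (Additive.ofMul _)) = P
    rw [hux, hφ, AddEquiv.symm_apply_apply]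

end Literature.NumberTheory.EllipticCurves.TateCurve

end
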